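import Mathlib
import Summits.Ventures.HodgeRepro.Tier4.Common.AdelicDefs

/-!
# Tier4/Common/UnitaryDet — the determinant of an element of the adelic unitary group squares to `1`
(the algebraic half of LINE L1's rung C5 «the adelic modulus», t4-L1-p5 S12723: `g B gᵀ = B ⇒ det g² = 1`)

Blind re-derivation cell `pub-hodge-repro`, Tier 4 (README §9–§10), seat t4-typer-2 (gen 2).  Target tree path
`lean/Summits/Ventures/HodgeRepro/Tier4/Common/UnitaryDet.lean`.  Imports `Tier4/Common/AdelicDefs.lean` only.

For `g ∈ unitaryGroup W = {g | g Ω = Ω g ∧ g B gᵀ = B}` and a non-degenerate trace form (`W.B.det ≠ 0`, the last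
clause of `IsGenuinePlane`), taking determinants in `g B gᵀ = B` gives `(det g)² · det B = det B` in `𝔸_k`, and
`det B = algebraMap k 𝔸_k (W.B.det)` is a UNIT of `𝔸_k` (the image of a non-zero element of the field `k`), so
**`(det g)² = 1`** (`GA.det_sq_eq_one`).  Nothing is said here about the adelic modulus `|det g|_𝔸` — that is the
analytic half of C5 (a Haar-measure statement on `𝔸_k⁴`), which this file does not touch: the only group fact the
rung needs is recorded, componentwise `det g = ±1` at every place.

Nothing here says anything about the status of the Hodge conjecture for CM abelian varieties, which is NOT proved
(HC_CM is NOT proved by anyone in this repository).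
-/

set_option autoImplicit false

noncomputable section

namespace Summit.Ventures.HodgeRepro.Tier4.Common

open NumberField Matrix
open scoped NumberField

variable {k : Type} [Field k] [NumberField k] (W : PlaneData k)

/-- The determinant of `adMat k A` is the image of `det A`. -/
theorem det_adMat (A : Matrix (Fin 4) (Fin 4) k) : (adMat k A).det = algebraMap k (Ad k) A.det := by
  rw [RingHom.map_det]
  rfl

/-- For a non-degenerate `A`, `det (adMat k A)` is a unit of `𝔸_k`. -/
theorem isUnit_det_adMat (A : Matrix (Fin 4) (Fin 4) k) (hA : A.det ≠ 0) : IsUnit (adMat k A).det := by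
  rw [det_adMat]
  exact (isUnit_iff_ne_zero.2 hA).map (algebraMap k (Ad k))

/-- `(det g)² · det B = det B` for `g` in the unitary group: the determinant of `g B gᵀ = B`. -/
theorem GA.det_sq_mul_det_B (g : GA W) :
    (GA.mat W g).det ^ 2 * (adMat k W.B).det = (adMat k W.B).det := by
  have h := ((mem_unitaryGroup W (g : GL4 k)).1 g.2).2
  have hdet := congrArg Matrix.det h
  rw [Matrix.det_mul, Matrix.det_mul, Matrix.det_transpose] at hdet
  calc (GA.mat W g).det ^ 2 * (adMat k W.B).det
      = (GA.mat W g).det * (adMat k W.B).det * (GA.mat W g).det := by ring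
    _ = (adMat k W.B).det := hdet

/-- **The determinant of an element of the adelic unitary group squares to `1`** (non-degenerate trace form). -/
theorem GA.det_sq_eq_one (hB : W.B.det ≠ 0) (g : GA W) : (GA.mat W g).det ^ 2 = 1 := by
  have hu := isUnit_det_adMat W.B hB
  have h := GA.det_sq_mul_det_B W g
  apply hu.mul_left_injective
  show (GA.mat W g).det ^ 2 * (adMat k W.B).det = 1 * (adMat k W.B).det
  rw [h, one_mul]

/-- The same for the inverse: `(det g⁻¹)² = 1`. -/
theorem GA.det_inv_sq_eq_one (hB : W.B.det ≠ 0) (g : GA W) : (GA.mat W g⁻¹).det ^ 2 = 1 :=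
  GA.det_sq_eq_one W hB g⁻¹

/-- `det g` is a unit of `𝔸_k` (its own inverse). -/
theorem GA.isUnit_det (hB : W.B.det ≠ 0) (g : GA W) : IsUnit (GA.mat W g).det :=
  ⟨⟨(GA.mat W g).det, (GA.mat W g).det, by rw [← sq, GA.det_sq_eq_one W hB g],
    by rw [← sq, GA.det_sq_eq_one W hB g]⟩, rfl⟩

end Summit.Ventures.HodgeRepro.Tier4.Common

end
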